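import Summits.NavierStokesRegularity.FluidComputer.LerayTimeFace
import Summits.NavierStokesRegularity.NavierStokesRegularity.Theorems.FluidComputerCascade
import HarnessLib

/-!
# Fluid computer — the time face READ ON THE INTERFACE: every cascade witness runs on Leray's clock

HONEST FRAMING (cell `pub-fluidc`, verbatim): *low prior, high value-of-information experiment on Tao's
machine paradigm; NOT a claim that NS blows up.* An implication from the cell's (uninhabited, as far as anyone
knows) interface structure `CascadeWitness`; nothing here is evidence of blow-up.

Companion of `CascadeWitnessFloor` (the level-Reynolds floor L1/L4 read on the interface) for the TIME FACE
(`LerayTimeFace.time_face`, L19–L23): the summit-side extraction `x5a_of_cascadeWitness'` turns a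
`CascadeWitness` into a maximal smooth Leray–Hopf solution of the unforced Navier–Stokes system on `ℝ³ × [0, T)`,
and every such solution obeys, with ONE absolute constant `c`, the DEADLINE `4cν⁵(T − t) ≤ ‖u(t)‖₂⁴`, the
COUNTDOWN `cν³ ≤ (∫|∇u(t)|²)²(T − t)`, the scale-invariant floor `2cν⁴ ≤ ‖u(t)‖₂² ∫|∇u(t)|²`, and the sup / block-sup
clocks `c√ν/√(T − t) ≤ ‖u(t)‖_∞ ≤ ∑_j ‖Δ̇_j u(t)‖_∞`. In the machine's words: whatever gadget library realises
the cascade, its schedule accelerates geometrically and fits inside Leray's window (the per-level countdowns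
(E)/(A) of `time_face` apply verbatim to the extracted solution). 0 sorry; no new definitions, no named facts.

## References

* J. Leray, Acta Math. 63 (1934) 193–248, §19–§20, §34. [Leray1934]
* J. C. Robinson, J. L. Rodrigo, W. Sadowski, *The Three-Dimensional Navier–Stokes Equations*, CUP 2016,
  Lemma 6.11. [RobinsonRodrigoSadowski2016]
-/

noncomputable section

open MeasureTheory Set Function Filter Topology
open scoped ENNReal NNReal
open Literature.Analysis.FluidPDE Literature.Analysis.FunctionSpaces Literature.Analysis.FluidPDE.FluidComputer
open Summit.NavierStokesRegularity.NavierStokesRegularity.Theorems.FluidComputer (x5a_of_cascadeWitness')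

namespace Summit.NavierStokesRegularity.FluidComputer.CascadeWitnessClock

/-- **Every cascade witness runs on Leray's clock.** There is an absolute `c > 0` such that every
`W : CascadeWitness` yields `ν > 0`, `T > 0` and a maximal smooth solution `(u, p)` of the unforced Navier–Stokes
system on `ℝ³ × [0, T)`, Leray–Hopf from `u 0`, with: (D) `4 c ν⁵ (T − t) ≤ ‖u(t)‖₂⁴` for every `t ∈ [0, T)`;
and for every `t ∈ (0, T)`: (C) `c ν³ ≤ (∫|∇u(t)|²)² (T − t)`, (P) `2 c ν⁴ ≤ ‖u(t)‖₂² ∫|∇u(t)|²`,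
(S) `c √ν/√(T − t) ≤ ‖u(t)‖_∞`, (B) `c √ν/√(T − t) ≤ ∑_j ‖Δ̇_j u(t)‖_∞` (`LerayTimeFace.time_face` composed with
`x5a_of_cascadeWitness'`). [cite: Leray1934, §19–§20 and §34] [cite: RobinsonRodrigoSadowski2016, Lemma 6.11] -/
theorem time_face_of_cascadeWitness :
    ∃ c : ℝ, 0 < c ∧ ∀ W : CascadeWitness, ∃ ν : ℝ, 0 < ν ∧ ∃ T : ℝ, 0 < T ∧
      ∃ (u : ℝ → EuclideanSpace ℝ (Fin 3) → EuclideanSpace ℝ (Fin 3))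
        (p : ℝ → EuclideanSpace ℝ (Fin 3) → ℝ),
        IsMaximalSmoothSolution ν 0 u p T ∧ IsLerayHopfOn T ν 0 (u 0) u ∧
        (∀ t ∈ Ico 0 T, 4 * c * ν ^ 5 * (T - t) ≤ (eLpNorm (u t) 2 volume).toReal ^ 4) ∧
        ∀ t ∈ Ioo 0 T,
          c * ν ^ 3 ≤ (∫⁻ x, ENNReal.ofReal (frobeniusNormSq (fderiv ℝ (u t) x))).toReal ^ 2 * (T - t) ∧
          2 * c * ν ^ 4 ≤ (eLpNorm (u t) 2 volume).toReal ^ 2 *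
            (∫⁻ x, ENNReal.ofReal (frobeniusNormSq (fderiv ℝ (u t) x))).toReal ∧
          ENNReal.ofReal (c * Real.sqrt ν / Real.sqrt (T - t)) ≤ eLpNorm (u t) ∞ volume ∧
          ENNReal.ofReal (c * Real.sqrt ν / Real.sqrt (T - t)) ≤ ∑' j : ℤ, blockSup (u t) j := by
  obtain ⟨c, hc, H⟩ := LerayTimeFace.time_face
  refine ⟨c, hc, fun W => ?_⟩
  obtain ⟨ν, hν, T, hT, u, p, hmax, hLH, -⟩ := x5a_of_cascadeWitness' W
  obtain ⟨hD, hrest⟩ := H ν T hν hT u p hmax hLH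
  refine ⟨ν, hν, T, hT, u, p, hmax, hLH, hD, fun t ht => ?_⟩
  obtain ⟨h1, h2, h3, h4, -, -⟩ := hrest t ht
  exact ⟨h1, h2, h3, h4⟩

end Summit.NavierStokesRegularity.FluidComputer.CascadeWitnessClock

end
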